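import Summits.HodgeConjecture.CorCM.MumfordTateRankUnitaryPairGraph
import HarnessLib

/-!
# Two unitary summands with simple derived algebras and no Hodge morphism between them: `𝔥(H₁ ⊕ H₂)` contains both derived corners
# (the unitary analogue of Moonen–Zarhin's Lemma (3.4), step 3: Goursat through the kernel ideals)

COR-CM (cell `pub-hodgecm2`, seat `b27` gen 52, count-neutral Mumford–Tate-rank ladder; theorems only, no definition, no named fact; UNCONDITIONAL —
nothing here uses or asserts HC_CM).  Sequel of `CorCM/MumfordTateRankUnitaryPair{Intertwiner,Graph}` (SETTING as there); in addition both `H_i` are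
`Θ`-rigid, `φ₁ ∈ 𝔥(H₁)`, the `ψ_i`-skew centres of `𝔥(H_i)` lie on `ℚφ_i`, the derived algebras `𝔡_i = [𝔥(H_i),𝔥(H_i)]` are SIMPLE (no `𝔡_i`-stable
subspaces but `0`, `𝔡_i`), centre-free and non-zero, and NO non-zero `ℚ`-linear `H₁ → H₂` respects the Hodge types.
RESULT **`corners_le_and_finrank_le`**: `ι₁𝔡₁π₁ ⊆ 𝔥(H)`, `ι₂𝔡₂π₂ ⊆ 𝔥(H)`, `dim 𝔡₁ + dim 𝔡₂ + 1 ≤ dim 𝔥(H)`.  PROOF.  The KERNEL IDEALS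
`K_i = {Y : ι_iYπ_i ∈ 𝔥(H)}` are ideals of `𝔥(H_i) = π_i𝔥(H)ι_i` (`incl_commutator_proj_mem`, rigidity), so `K_i ∩ 𝔡_i ∈ {0, 𝔡_i}`.  If
`K₁ ∩ 𝔡₁ = 0`, every `Y ∈ K₁` is `cφ₁ + d` with `[𝔥₁, d] = 0`, so `K₁ ⊆ ℚφ₁`; if moreover `ι₂𝔡₂π₂ ⊆ 𝔥(H)`, the lifts `ι₁Xπ₁ + cι₂φ₂π₂ ∈ 𝔥(H)` of
`X ∈ 𝔡₁` bracket to `ι₁[X,X′]π₁`, forcing `[𝔡₁,𝔡₁] ⊆ K₁ ∩ 𝔡₁ = 0`, `𝔡₁` abelian, `𝔡₁ = 0` — absurd; and if also `K₂ ∩ 𝔡₂ = 0` the pair is in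
GRAPH POSITION (complexified through `mem_spanC_ker_of_map_eq_zero`), excluded by `exists_hodgeMorphism_of_graph`.  So `K_i ⊇ 𝔡_i`; the corners are
independent and a lift of `φ₁ ∉ 𝔡₁` (`tr(φ₁²) ≠ 0 = tr(dφ₁)`) adds one dimension.

## References
* [MoonenZarhin1999LowDim] B. Moonen, Yu. G. Zarhin, *Hodge classes on abelian varieties of low dimension*, Math. Ann. 315 (1999), §3 (3.1) and
  Lemma (3.4) [corpus: paper:arxiv-math_9901113 p. 6]. [cite: MoonenZarhin1999LowDim, §3 (3.1) and Lemma (3.4)]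
* [Hazama1983] F. Hazama, Tôhoku Math. J. 35 (1983), Lemma (3.1) (Goursat). [cite: Hazama1983, Lemma (3.1)]
* [Deligne1982HodgeCycles] P. Deligne, LNM 900 (1982), I §3 Prop. 3.4, Prop. 3.6. [cite: Deligne1982HodgeCycles, I §3 Prop. 3.6]
-/

noncomputable section

open scoped TensorProduct

namespace Summit.HodgeConjecture.CorCM

namespace UnitaryPair

open Literature.AlgebraicGeometry.Motives Literature.AlgebraicGeometry.Motives.HodgeStructure Module

universe u

variable {V₁ : Type u} [AddCommGroup V₁] [Module ℚ V₁] [Module.Finite ℚ V₁]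
  {V₂ : Type u} [AddCommGroup V₂] [Module ℚ V₂] [Module.Finite ℚ V₂]
  {V : Type u} [AddCommGroup V] [Module ℚ V] [Module.Finite ℚ V] [HodgeTensorFacts.{u, u}] {n : ℤ}
  {H₁ : HodgeStructure V₁ n} {H₂ : HodgeStructure V₂ n} {H : HodgeStructure V n}
  (ι₁ : Hom H₁ H) (π₁ : Hom H H₁) (ι₂ : Hom H₂ H) (π₂ : Hom H H₂)
  (hπι₁ : ∀ v, π₁.toLinearMap (ι₁.toLinearMap v) = v) (hπι₂ : ∀ v, π₂.toLinearMap (ι₂.toLinearMap v) = v)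
  (hsum : ∀ v, ι₁.toLinearMap (π₁.toLinearMap v) + ι₂.toLinearMap (π₂.toLinearMap v) = v)

/-! ## §1 The kernel ideal of a rigid summand -/

section Kernel

variable (hrig₁ : ∀ 𝔞 : Submodule ℚ (Module.End ℚ V₁), 𝔞 ≤ H₁.hodgeLie →
      (∀ X ∈ 𝔞, ∀ Y ∈ 𝔞, X * Y - Y * X ∈ 𝔞) →
      (∃ Θ ∈ Submodule.span ℂ ((fun X : Module.End ℚ V₁ => X.baseChange ℂ) '' (𝔞 : Set (Module.End ℚ V₁))),
        ∀ p, ∀ x ∈ H₁.piece p (n - p), Θ x = ((2 * p - n : ℤ) : ℂ) • x) → H₁.hodgeLie ≤ 𝔞)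

omit [Module.Finite ℚ V₂] in
include hπι₁ hπι₂ hsum hrig₁ in
/-- **The kernel ideal is an ideal**: for `Y` with `ι₁Yπ₁ ∈ 𝔥(H)` and `X ∈ 𝔥(H₁)`, also `ι₁[X,Y]π₁ ∈ 𝔥(H)` — lift `X` to `X̃ ∈ 𝔥(H)` by the rigidity of
`H₁` (`exists_restrict_eq_of_rigid`); `X̃ι₁ = ι₁X`, `π₁X̃ = Xπ₁` (block form), so `[X̃, ι₁Yπ₁] = ι₁[X,Y]π₁`. [cite: Hazama1983, Lemma (3.1)]
[cite: MoonenZarhin1999LowDim, §3 (3.1) and Lemma (3.4)] -/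
theorem incl_commutator_proj_mem {X Y : Module.End ℚ V₁} (hX : X ∈ H₁.hodgeLie) (hY : ι₁.toLinearMap ∘ₗ Y ∘ₗ π₁.toLinearMap ∈ H.hodgeLie) :
    ι₁.toLinearMap ∘ₗ (X * Y - Y * X) ∘ₗ π₁.toLinearMap ∈ H.hodgeLie := by
  obtain ⟨Xt, hXt, hXtX⟩ := exists_restrict_eq_of_rigid ι₁ π₁ hπι₁ hrig₁ hX
  have h12 : ∀ w, π₁.toLinearMap (ι₂.toLinearMap w) = 0 := fun w => by
    simpa only [LinearMap.comp_apply, LinearMap.zero_apply] using congrArg (fun f => f w) (proj₁_comp_incl₂ ι₁ π₁ ι₂ π₂ hπι₁ hπι₂ hsum)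
  have h1 : ∀ w, Xt (ι₁.toLinearMap w) = ι₁.toLinearMap (X w) := fun w => by
    have h := congrArg (fun f => f w) (comp_incl_eq_incl_comp_restrict ι₁ π₁ hπι₁ hXt)
    simp only [LinearMap.comp_apply] at h
    rw [h, ← hXtX, LinearMap.comp_apply, LinearMap.comp_apply]
  have h2 : ∀ v, π₁.toLinearMap (Xt v) = X (π₁.toLinearMap v) := fun v => by
    have h := congrArg (fun f => π₁.toLinearMap (f v)) (eq_sum_blocks_of_mem_hodgeLie ι₁ π₁ ι₂ π₂ hπι₁ hπι₂ hsum hXt)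
    simp only [LinearMap.add_apply, LinearMap.comp_apply, map_add, hπι₁, h12, add_zero] at h
    rw [h, ← hXtX, LinearMap.comp_apply, LinearMap.comp_apply]
  have heq : Xt * (ι₁.toLinearMap ∘ₗ Y ∘ₗ π₁.toLinearMap) - (ι₁.toLinearMap ∘ₗ Y ∘ₗ π₁.toLinearMap) * Xt =
      ι₁.toLinearMap ∘ₗ (X * Y - Y * X) ∘ₗ π₁.toLinearMap :=
    LinearMap.ext fun v => by simp only [LinearMap.sub_apply, LinearMap.comp_apply, Module.End.mul_apply, h1, h2, map_sub]
  exact heq ▸ H.commutator_mem_hodgeLie hXt hY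

end Kernel

/-! ## §2 Both derived corners lie in `𝔥(H)` -/

section Main

variable (hn : n = 1) (heff₁ : H₁.IsEffective) (heff₂ : H₂.IsEffective) (ψ₁ : H₁.Polarization) (ψ₂ : H₂.Polarization) (ψ : H.Polarization)
  {φ₁ : Module.End ℚ V₁} (hφ₁E : φ₁ ∈ H₁.endAlg) {d₁ : ℚ} (hd₁ : 0 < d₁) (hφ₁2 : φ₁ * φ₁ = -(d₁ • 1))
  (hE₁ : ∀ a ∈ H₁.endAlg, ∃ x y : ℚ, a = x • 1 + y • φ₁) {μ₁ : ℂ} (hμ₁ : μ₁ ^ 2 = -(d₁ : ℂ))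
  (h1₁ : Module.finrank ℂ ↥(Module.End.eigenspace (φ₁.baseChange ℂ) μ₁ ⊓ H₁.piece 0 1) = 1)
  (h2₁ : 2 ≤ Module.finrank ℂ ↥(Module.End.eigenspace (φ₁.baseChange ℂ) μ₁ ⊓ H₁.piece 1 0))
  {φ₂ : Module.End ℚ V₂} (hφ₂E : φ₂ ∈ H₂.endAlg) {d₂ : ℚ} (hd₂ : 0 < d₂) (hφ₂2 : φ₂ * φ₂ = -(d₂ • 1))
  (hE₂ : ∀ a ∈ H₂.endAlg, ∃ x y : ℚ, a = x • 1 + y • φ₂) {μ₂ : ℂ} (hμ₂ : μ₂ ^ 2 = -(d₂ : ℂ))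
  (h1₂ : Module.finrank ℂ ↥(Module.End.eigenspace (φ₂.baseChange ℂ) μ₂ ⊓ H₂.piece 0 1) = 1)
  (h2₂ : 2 ≤ Module.finrank ℂ ↥(Module.End.eigenspace (φ₂.baseChange ℂ) μ₂ ⊓ H₂.piece 1 0))
  (hrig₁ : ∀ 𝔞 : Submodule ℚ (Module.End ℚ V₁), 𝔞 ≤ H₁.hodgeLie →
      (∀ X ∈ 𝔞, ∀ Y ∈ 𝔞, X * Y - Y * X ∈ 𝔞) →
      (∃ Θ ∈ Submodule.span ℂ ((fun X : Module.End ℚ V₁ => X.baseChange ℂ) '' (𝔞 : Set (Module.End ℚ V₁))),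
        ∀ p, ∀ x ∈ H₁.piece p (n - p), Θ x = ((2 * p - n : ℤ) : ℂ) • x) → H₁.hodgeLie ≤ 𝔞)
  (hrig₂ : ∀ 𝔞 : Submodule ℚ (Module.End ℚ V₂), 𝔞 ≤ H₂.hodgeLie →
      (∀ X ∈ 𝔞, ∀ Y ∈ 𝔞, X * Y - Y * X ∈ 𝔞) →
      (∃ Θ ∈ Submodule.span ℂ ((fun X : Module.End ℚ V₂ => X.baseChange ℂ) '' (𝔞 : Set (Module.End ℚ V₂))),
        ∀ p, ∀ x ∈ H₂.piece p (n - p), Θ x = ((2 * p - n : ℤ) : ℂ) • x) → H₂.hodgeLie ≤ 𝔞)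
  (hZ : ∀ z ∈ H.hodgeLie ⊓ Subalgebra.toSubmodule H.endAlg, ∃ x₁ x₂ : ℚ,
      z = x₁ • (ι₁.toLinearMap ∘ₗ φ₁ ∘ₗ π₁.toLinearMap) + x₂ • (ι₂.toLinearMap ∘ₗ φ₂ ∘ₗ π₂.toLinearMap))
  (hφ₁𝔥 : φ₁ ∈ H₁.hodgeLie)
  (hZ₁ : ∀ z ∈ H₁.hodgeLie ⊓ Subalgebra.toSubmodule H₁.endAlg, ∃ c : ℚ, z = c • φ₁)
  (hZ₂ : ∀ z ∈ H₂.hodgeLie ⊓ Subalgebra.toSubmodule H₂.endAlg, ∃ c : ℚ, z = c • φ₂)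
  (hsimple₁ : ∀ 𝔡 I : Submodule ℚ (Module.End ℚ V₁), 𝔡 = Submodule.span ℚ {B | ∃ X ∈ H₁.hodgeLie, ∃ Y ∈ H₁.hodgeLie, X * Y - Y * X = B} →
      I ≤ 𝔡 → (∀ X ∈ 𝔡, ∀ Y ∈ I, X * Y - Y * X ∈ I) → I = ⊥ ∨ I = 𝔡)
  (hsimple₂ : ∀ 𝔡 I : Submodule ℚ (Module.End ℚ V₂), 𝔡 = Submodule.span ℚ {B | ∃ X ∈ H₂.hodgeLie, ∃ Y ∈ H₂.hodgeLie, X * Y - Y * X = B} →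
      I ≤ 𝔡 → (∀ X ∈ 𝔡, ∀ Y ∈ I, X * Y - Y * X ∈ I) → I = ⊥ ∨ I = 𝔡)
  (hcent₁ : ∀ 𝔡 : Submodule ℚ (Module.End ℚ V₁), 𝔡 = Submodule.span ℚ {B | ∃ X ∈ H₁.hodgeLie, ∃ Y ∈ H₁.hodgeLie, X * Y - Y * X = B} →
      ∀ d ∈ 𝔡, (∀ X ∈ 𝔡, X * d = d * X) → d = 0)
  (hcent₂ : ∀ 𝔡 : Submodule ℚ (Module.End ℚ V₂), 𝔡 = Submodule.span ℚ {B | ∃ X ∈ H₂.hodgeLie, ∃ Y ∈ H₂.hodgeLie, X * Y - Y * X = B} →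
      ∀ d ∈ 𝔡, (∀ X ∈ 𝔡, X * d = d * X) → d = 0)
  (h𝔡₁0 : Submodule.span ℚ {B | ∃ X ∈ H₁.hodgeLie, ∃ Y ∈ H₁.hodgeLie, X * Y - Y * X = B} ≠ ⊥)
  (h𝔡₂0 : Submodule.span ℚ {B | ∃ X ∈ H₂.hodgeLie, ∃ Y ∈ H₂.hodgeLie, X * Y - Y * X = B} ≠ ⊥)
  (hnohom : ∀ f : V₁ →ₗ[ℚ] V₂, (∀ p, ∀ x ∈ H₁.piece p (n - p), f.baseChange ℂ x ∈ H₂.piece p (n - p)) → f = 0)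

include hπι₁ hπι₂ hsum hn heff₁ heff₂ ψ₁ ψ₂ ψ hφ₁E hd₁ hφ₁2 hE₁ hμ₁ h1₁ h2₁ hφ₂E hd₂ hφ₂2 hE₂ hμ₂ h1₂ h2₂ hrig₁ hrig₂ hZ hφ₁𝔥 hZ₁ hZ₂
  hsimple₁ hsimple₂ hcent₁ hcent₂ h𝔡₁0 h𝔡₂0 hnohom in
set_option maxHeartbeats 800000 in
/-- **Goursat for two unitary summands of Ribet type `(m_i,1)`: `𝔥(H₁ ⊕ H₂) ⊇ ι₁[𝔥₁,𝔥₁]π₁ ⊕ ι₂[𝔥₂,𝔥₂]π₂`, and `dim 𝔥(H) ≥ dim 𝔡₁ + dim 𝔡₂ + 1`,**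
provided the derived algebras `𝔡_i` are simple with trivial centre and no non-zero Hodge morphism `H₁ → H₂` exists (proof in the module docstring:
kernel ideals, simplicity, and the graph case excluded by `exists_hodgeMorphism_of_graph`). [cite: MoonenZarhin1999LowDim, §3 (3.1) and Lemma (3.4)]
[cite: Hazama1983, Lemma (3.1)] [cite: Deligne1982HodgeCycles, I §3 Prop. 3.6] -/
theorem corners_le_and_finrank_le :
    (Submodule.span ℚ {B | ∃ X ∈ H₁.hodgeLie, ∃ Y ∈ H₁.hodgeLie, X * Y - Y * X = B}).map
        ((LinearMap.llcomp ℚ V V₁ V ι₁.toLinearMap).comp (LinearMap.lcomp ℚ V₁ π₁.toLinearMap)) ≤ H.hodgeLie ∧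
      (Submodule.span ℚ {B | ∃ X ∈ H₂.hodgeLie, ∃ Y ∈ H₂.hodgeLie, X * Y - Y * X = B}).map
        ((LinearMap.llcomp ℚ V V₂ V ι₂.toLinearMap).comp (LinearMap.lcomp ℚ V₂ π₂.toLinearMap)) ≤ H.hodgeLie ∧
      Module.finrank ℚ ↥(Submodule.span ℚ {B | ∃ X ∈ H₁.hodgeLie, ∃ Y ∈ H₁.hodgeLie, X * Y - Y * X = B}) +
        Module.finrank ℚ ↥(Submodule.span ℚ {B | ∃ X ∈ H₂.hodgeLie, ∃ Y ∈ H₂.hodgeLie, X * Y - Y * X = B}) + 1 ≤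
        Module.finrank ℚ H.hodgeLie := by
  classical
  set 𝔥 := H.hodgeLie
  set 𝔡₁ : Submodule ℚ (Module.End ℚ V₁) := Submodule.span ℚ {B | ∃ X ∈ H₁.hodgeLie, ∃ Y ∈ H₁.hodgeLie, X * Y - Y * X = B} with h𝔡₁def
  set 𝔡₂ : Submodule ℚ (Module.End ℚ V₂) := Submodule.span ℚ {B | ∃ X ∈ H₂.hodgeLie, ∃ Y ∈ H₂.hodgeLie, X * Y - Y * X = B} with h𝔡₂def
  set c₁ : Module.End ℚ V₁ →ₗ[ℚ] Module.End ℚ V := (LinearMap.llcomp ℚ V V₁ V ι₁.toLinearMap).comp (LinearMap.lcomp ℚ V₁ π₁.toLinearMap) with hc₁def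
  set c₂ : Module.End ℚ V₂ →ₗ[ℚ] Module.End ℚ V := (LinearMap.llcomp ℚ V V₂ V ι₂.toLinearMap).comp (LinearMap.lcomp ℚ V₂ π₂.toLinearMap) with hc₂def
  have hc₁ : ∀ Y, c₁ Y = ι₁.toLinearMap ∘ₗ Y ∘ₗ π₁.toLinearMap := fun Y => rfl; have hc₂ : ∀ Y, c₂ Y = ι₂.toLinearMap ∘ₗ Y ∘ₗ π₂.toLinearMap := fun Y => rfl
  let r₁ : Module.End ℚ V →ₗ[ℚ] Module.End ℚ V₁ := (LinearMap.llcomp ℚ V₁ V V₁ π₁.toLinearMap).comp (LinearMap.lcomp ℚ V ι₁.toLinearMap)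
  let r₂ : Module.End ℚ V →ₗ[ℚ] Module.End ℚ V₂ := (LinearMap.llcomp ℚ V₂ V V₂ π₂.toLinearMap).comp (LinearMap.lcomp ℚ V ι₂.toLinearMap)
  have hr₁ : ∀ X, r₁ X = π₁.toLinearMap ∘ₗ X ∘ₗ ι₁.toLinearMap := fun X => rfl; have hr₂ : ∀ X, r₂ X = π₂.toLinearMap ∘ₗ X ∘ₗ ι₂.toLinearMap := fun X => rfl
  have hπι₁' : π₁.toLinearMap ∘ₗ ι₁.toLinearMap = LinearMap.id := LinearMap.ext hπι₁
  have hπι₂' : π₂.toLinearMap ∘ₗ ι₂.toLinearMap = LinearMap.id := LinearMap.ext hπι₂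
  have hsum' : ∀ v, ι₂.toLinearMap (π₂.toLinearMap v) + ι₁.toLinearMap (π₁.toLinearMap v) = v := fun v => by rw [add_comm]; exact hsum v
  have hr₁c₁ : ∀ Y, r₁ (c₁ Y) = Y := fun Y => by rw [hr₁, hc₁]; refine LinearMap.ext fun v => ?_; simp only [LinearMap.comp_apply, hπι₁]
  have hr₂c₂ : ∀ Y, r₂ (c₂ Y) = Y := fun Y => by rw [hr₂, hc₂]; refine LinearMap.ext fun v => ?_; simp only [LinearMap.comp_apply, hπι₂]
  have h12 : ∀ w, π₁.toLinearMap (ι₂.toLinearMap w) = 0 := fun w => by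
    simpa only [LinearMap.comp_apply, LinearMap.zero_apply] using congrArg (fun f => f w) (proj₁_comp_incl₂ ι₁ π₁ ι₂ π₂ hπι₁ hπι₂ hsum)
  have h21 : ∀ w, π₂.toLinearMap (ι₁.toLinearMap w) = 0 := fun w => by
    simpa only [LinearMap.comp_apply, LinearMap.zero_apply] using congrArg (fun f => f w) (proj₂_comp_incl₁ ι₁ π₁ ι₂ π₂ hπι₁ hπι₂ hsum)
  have hr₁c₂ : ∀ Y, r₁ (c₂ Y) = 0 := fun Y => by rw [hr₁, hc₂]; refine LinearMap.ext fun v => ?_; simp only [LinearMap.comp_apply, h12, LinearMap.zero_apply]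
  have hr₂c₁ : ∀ Y, r₂ (c₁ Y) = 0 := fun Y => by rw [hr₂, hc₁]; refine LinearMap.ext fun v => ?_; simp only [LinearMap.comp_apply, h21, LinearMap.zero_apply]
  have h𝔡₁𝔥 : 𝔡₁ ≤ H₁.hodgeLie := Submodule.span_le.2 (by rintro _ ⟨X, hX, Y, hY, rfl⟩; exact H₁.commutator_mem_hodgeLie hX hY)
  have h𝔡₂𝔥 : 𝔡₂ ≤ H₂.hodgeLie := Submodule.span_le.2 (by rintro _ ⟨X, hX, Y, hY, rfl⟩; exact H₂.commutator_mem_hodgeLie hX hY)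
  set K₁ : Submodule ℚ (Module.End ℚ V₁) := 𝔥.comap c₁
  set K₂ : Submodule ℚ (Module.End ℚ V₂) := 𝔥.comap c₂
  have hK₁𝔥 : K₁ ≤ H₁.hodgeLie := fun Y hY => by
    have h := comp_mem_hodgeLie_of_retract ι₁ π₁ hπι₁ (Submodule.mem_comap.1 hY); rw [← hr₁, hr₁c₁] at h; exact h
  have hK₂𝔥 : K₂ ≤ H₂.hodgeLie := fun Y hY => by
    have h := comp_mem_hodgeLie_of_retract ι₂ π₂ hπι₂ (Submodule.mem_comap.1 hY); rw [← hr₂, hr₂c₂] at h; exact h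
  have hK₁id : ∀ X ∈ H₁.hodgeLie, ∀ Y ∈ K₁, X * Y - Y * X ∈ K₁ := fun X hX Y hY =>
    Submodule.mem_comap.2 (by rw [hc₁]; exact incl_commutator_proj_mem ι₁ π₁ ι₂ π₂ hπι₁ hπι₂ hsum hrig₁ hX (hc₁ Y ▸ Submodule.mem_comap.1 hY))
  have hK₂id : ∀ X ∈ H₂.hodgeLie, ∀ Y ∈ K₂, X * Y - Y * X ∈ K₂ := fun X hX Y hY =>
    Submodule.mem_comap.2 (by rw [hc₂]; exact incl_commutator_proj_mem ι₂ π₂ ι₁ π₁ hπι₂ hπι₁ hsum' hrig₂ hX (hc₂ Y ▸ Submodule.mem_comap.1 hY))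
  have hI₁ := hsimple₁ 𝔡₁ (K₁ ⊓ 𝔡₁) rfl inf_le_right (fun X hX Y hY => Submodule.mem_inf.2
    ⟨hK₁id X (h𝔡₁𝔥 hX) Y (Submodule.mem_inf.1 hY).1, Submodule.subset_span ⟨X, h𝔡₁𝔥 hX, Y, hK₁𝔥 (Submodule.mem_inf.1 hY).1, rfl⟩⟩)
  have hI₂ := hsimple₂ 𝔡₂ (K₂ ⊓ 𝔡₂) rfl inf_le_right (fun X hX Y hY => Submodule.mem_inf.2
    ⟨hK₂id X (h𝔡₂𝔥 hX) Y (Submodule.mem_inf.1 hY).1, Submodule.subset_span ⟨X, h𝔡₂𝔥 hX, Y, hK₂𝔥 (Submodule.mem_inf.1 hY).1, rfl⟩⟩)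
  -- (i) a derived kernel which is zero makes the kernel central: `K_i ⊆ ℚφ_i`
  have hKline₁ : K₁ ⊓ 𝔡₁ = ⊥ → ∀ Y ∈ K₁, ∃ c : ℚ, Y = c • φ₁ := by
    intro h0 Y hY
    have hY𝔥 : Y ∈ H₁.hodgeLie := hK₁𝔥 hY
    rw [← AnyWeight.hodgeLie_center_sup_derived_eq H₁ ψ₁] at hY𝔥
    obtain ⟨z, hz, d, hd, rfl⟩ := Submodule.mem_sup.1 hY𝔥
    obtain ⟨c, rfl⟩ := hZ₁ z hz
    have hdc : ∀ X ∈ 𝔡₁, X * d = d * X := by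
      intro X hX
      have h1 : X * (c • φ₁ + d) - (c • φ₁ + d) * X ∈ K₁ ⊓ 𝔡₁ :=
        Submodule.mem_inf.2 ⟨hK₁id X (h𝔡₁𝔥 hX) _ hY, Submodule.subset_span ⟨X, h𝔡₁𝔥 hX, _, hK₁𝔥 hY, rfl⟩⟩
      rw [h0, Submodule.mem_bot] at h1
      have hXφ : X * φ₁ = φ₁ * X := commute_of_mem_hodgeLie H₁ (h𝔡₁𝔥 hX) ⟨φ₁, hφ₁E⟩
      rw [mul_add, add_mul, mul_smul_comm, smul_mul_assoc, hXφ, add_sub_add_left_eq_sub, sub_eq_zero] at h1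
      exact h1
    rw [hcent₁ 𝔡₁ rfl d hd hdc, add_zero]
    exact ⟨c, rfl⟩
  have hKline₂ : K₂ ⊓ 𝔡₂ = ⊥ → ∀ Y ∈ K₂, ∃ c : ℚ, Y = c • φ₂ := by
    intro h0 Y hY
    have hY𝔥 : Y ∈ H₂.hodgeLie := hK₂𝔥 hY
    rw [← AnyWeight.hodgeLie_center_sup_derived_eq H₂ ψ₂] at hY𝔥
    obtain ⟨z, hz, d, hd, rfl⟩ := Submodule.mem_sup.1 hY𝔥
    obtain ⟨c, rfl⟩ := hZ₂ z hz
    have hdc : ∀ X ∈ 𝔡₂, X * d = d * X := by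
      intro X hX
      have h1 : X * (c • φ₂ + d) - (c • φ₂ + d) * X ∈ K₂ ⊓ 𝔡₂ :=
        Submodule.mem_inf.2 ⟨hK₂id X (h𝔡₂𝔥 hX) _ hY, Submodule.subset_span ⟨X, h𝔡₂𝔥 hX, _, hK₂𝔥 hY, rfl⟩⟩
      rw [h0, Submodule.mem_bot] at h1
      have hXφ : X * φ₂ = φ₂ * X := commute_of_mem_hodgeLie H₂ (h𝔡₂𝔥 hX) ⟨φ₂, hφ₂E⟩
      rw [mul_add, add_mul, mul_smul_comm, smul_mul_assoc, hXφ, add_sub_add_left_eq_sub, sub_eq_zero] at h1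
      exact h1
    rw [hcent₂ 𝔡₂ rfl d hd hdc, add_zero]
    exact ⟨c, rfl⟩
  -- (ii) a zero derived kernel on one side and the derived corner on the other side make `𝔡` abelian: impossible
  have hmixed₁ : K₁ ⊓ 𝔡₁ = ⊥ → ¬ 𝔡₂.map c₂ ≤ 𝔥 := by
    intro h0 hle
    apply h𝔡₁0
    -- every `X ∈ 𝔡₁` has a lift `c₁ X + c • c₂ φ₂ ∈ 𝔥`
    have hlift : ∀ X ∈ 𝔡₁, ∃ c : ℚ, c₁ X + c • c₂ φ₂ ∈ 𝔥 := by
      intro X hX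
      obtain ⟨Xt, hXt, hXtX⟩ := exists_restrict_eq_of_rigid ι₁ π₁ hπι₁ hrig₁ (h𝔡₁𝔥 hX)
      have hX₂ : r₂ Xt ∈ H₂.hodgeLie := by rw [hr₂]; exact comp_mem_hodgeLie_of_retract ι₂ π₂ hπι₂ hXt
      rw [← AnyWeight.hodgeLie_center_sup_derived_eq H₂ ψ₂] at hX₂
      obtain ⟨z, hz, d, hd, hzd⟩ := Submodule.mem_sup.1 hX₂
      obtain ⟨c, rfl⟩ := hZ₂ z hz
      refine ⟨c, ?_⟩
      have heq : c₁ X + c • c₂ φ₂ = Xt - c₂ d := by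
        have h := eq_sum_blocks_of_mem_hodgeLie ι₁ π₁ ι₂ π₂ hπι₁ hπι₂ hsum hXt
        rw [hXtX, ← hr₂, ← hzd] at h
        rw [h]
        refine LinearMap.ext fun v => ?_
        simp only [hc₁, hc₂, LinearMap.add_apply, LinearMap.sub_apply, LinearMap.smul_apply, LinearMap.comp_apply, map_add, map_smul]
        abel
      rw [heq]
      exact Submodule.sub_mem _ hXt (hle ⟨d, hd, rfl⟩)
    -- hence `[X, X'] ∈ K₁ ⊓ 𝔡₁ = 0` for `X, X' ∈ 𝔡₁`
    have hab : ∀ X ∈ 𝔡₁, ∀ X' ∈ 𝔡₁, X * X' = X' * X := by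
      intro X hX X' hX'
      obtain ⟨c, hcX⟩ := hlift X hX
      obtain ⟨c', hcX'⟩ := hlift X' hX'
      have hbr := H.commutator_mem_hodgeLie hcX hcX'
      have heq : (c₁ X + c • c₂ φ₂) * (c₁ X' + c' • c₂ φ₂) - (c₁ X' + c' • c₂ φ₂) * (c₁ X + c • c₂ φ₂) = c₁ (X * X' - X' * X) := by
        refine LinearMap.ext fun v => ?_
        simp only [hc₁, hc₂, LinearMap.sub_apply, LinearMap.add_apply, LinearMap.smul_apply, Module.End.mul_apply, LinearMap.comp_apply,
          map_add, map_smul, map_sub, hπι₁, hπι₂, h12, h21, map_zero, smul_zero, add_zero, zero_add]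
        module
      rw [heq] at hbr
      have hmem : X * X' - X' * X ∈ K₁ ⊓ 𝔡₁ := Submodule.mem_inf.2 ⟨Submodule.mem_comap.2 hbr, Submodule.subset_span ⟨X, h𝔡₁𝔥 hX, X', h𝔡₁𝔥 hX', rfl⟩⟩
      rw [h0, Submodule.mem_bot, sub_eq_zero] at hmem
      exact hmem
    exact (Submodule.eq_bot_iff _).2 fun d hd => hcent₁ 𝔡₁ rfl d hd fun X hX => hab X hX d hd
  have hmixed₂ : K₂ ⊓ 𝔡₂ = ⊥ → ¬ 𝔡₁.map c₁ ≤ 𝔥 := by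
    intro h0 hle
    apply h𝔡₂0
    have hlift : ∀ X ∈ 𝔡₂, ∃ c : ℚ, c₂ X + c • c₁ φ₁ ∈ 𝔥 := by
      intro X hX
      obtain ⟨Xt, hXt, hXtX⟩ := exists_restrict_eq_of_rigid ι₂ π₂ hπι₂ hrig₂ (h𝔡₂𝔥 hX)
      have hX₁ : r₁ Xt ∈ H₁.hodgeLie := by rw [hr₁]; exact comp_mem_hodgeLie_of_retract ι₁ π₁ hπι₁ hXt
      rw [← AnyWeight.hodgeLie_center_sup_derived_eq H₁ ψ₁] at hX₁
      obtain ⟨z, hz, d, hd, hzd⟩ := Submodule.mem_sup.1 hX₁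
      obtain ⟨c, rfl⟩ := hZ₁ z hz
      refine ⟨c, ?_⟩
      have heq : c₂ X + c • c₁ φ₁ = Xt - c₁ d := by
        have h := eq_sum_blocks_of_mem_hodgeLie ι₁ π₁ ι₂ π₂ hπι₁ hπι₂ hsum hXt
        rw [hXtX, ← hr₁, ← hzd] at h
        rw [h]
        refine LinearMap.ext fun v => ?_
        simp only [hc₁, hc₂, LinearMap.add_apply, LinearMap.sub_apply, LinearMap.smul_apply, LinearMap.comp_apply, map_add, map_smul]
        abel
      rw [heq]
      exact Submodule.sub_mem _ hXt (hle ⟨d, hd, rfl⟩)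
    have hab : ∀ X ∈ 𝔡₂, ∀ X' ∈ 𝔡₂, X * X' = X' * X := by
      intro X hX X' hX'
      obtain ⟨c, hcX⟩ := hlift X hX
      obtain ⟨c', hcX'⟩ := hlift X' hX'
      have hbr := H.commutator_mem_hodgeLie hcX hcX'
      have heq : (c₂ X + c • c₁ φ₁) * (c₂ X' + c' • c₁ φ₁) - (c₂ X' + c' • c₁ φ₁) * (c₂ X + c • c₁ φ₁) = c₂ (X * X' - X' * X) := by
        refine LinearMap.ext fun v => ?_
        simp only [hc₁, hc₂, LinearMap.sub_apply, LinearMap.add_apply, LinearMap.smul_apply, Module.End.mul_apply, LinearMap.comp_apply,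
          map_add, map_smul, map_sub, hπι₁, hπι₂, h12, h21, map_zero, smul_zero, add_zero, zero_add]
        module
      rw [heq] at hbr
      have hmem : X * X' - X' * X ∈ K₂ ⊓ 𝔡₂ := Submodule.mem_inf.2 ⟨Submodule.mem_comap.2 hbr, Submodule.subset_span ⟨X, h𝔡₂𝔥 hX, X', h𝔡₂𝔥 hX', rfl⟩⟩
      rw [h0, Submodule.mem_bot, sub_eq_zero] at hmem
      exact hmem
    exact (Submodule.eq_bot_iff _).2 fun d hd => hcent₂ 𝔡₂ rfl d hd fun X hX => hab X hX d hd
  -- (iii) both derived kernels zero: graph position, excluded by `exists_hodgeMorphism_of_graph`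
  have hgraph : ¬ (K₁ ⊓ 𝔡₁ = ⊥ ∧ K₂ ⊓ 𝔡₂ = ⊥) := by
    rintro ⟨h0₁, h0₂⟩
    have hKφ₁ := hKline₁ h0₁
    have hKφ₂ := hKline₂ h0₂
    -- complexification of the kernel conditions
    have hcx : ∀ {U : Type u} [AddCommGroup U] [Module ℚ U] [Module.Finite ℚ U] (r : Module.End ℚ V →ₗ[ℚ] Module.End ℚ U)
        (rC : Module.End ℂ (ℂ ⊗[ℚ] V) →ₗ[ℂ] Module.End ℂ (ℂ ⊗[ℚ] U)) (hrC : ∀ X : Module.End ℚ V, rC (X.baseChange ℂ) = (r X).baseChange ℂ)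
        (E : Module.End ℚ V) (hker : ∀ X ∈ 𝔥, r X = 0 → ∃ c : ℚ, X = c • E)
        {Z : Module.End ℂ (ℂ ⊗[ℚ] V)}, Z ∈ spanC 𝔥 → rC Z = 0 → ∃ k : ℂ, Z = k • E.baseChange ℂ := by
      intro U _ _ _ r rC hrC E hker Z hZ hZ0
      have h1 : Z ∈ spanC (𝔥 ⊓ LinearMap.ker r) := by
        rw [spanC_inf]; exact ⟨hZ, mem_spanC_ker_of_map_eq_zero r rC hrC hZ0⟩
      have h2 : spanC (𝔥 ⊓ LinearMap.ker r) ≤ ℂ ∙ E.baseChange ℂ := by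
        refine Submodule.span_le.2 ?_
        rintro _ ⟨X, hX, rfl⟩
        obtain ⟨c, rfl⟩ := hker X hX.1 (LinearMap.mem_ker.1 hX.2)
        refine Submodule.mem_span_singleton.2 ⟨(c : ℂ), ?_⟩
        refine TensorProduct.AlgebraTensorModule.ext fun z v => ?_
        rw [LinearMap.baseChange_tmul, LinearMap.smul_apply, LinearMap.smul_apply, LinearMap.baseChange_tmul,
          TensorProduct.smul_tmul', ← TensorProduct.smul_tmul, Rat.smul_def, smul_eq_mul]
      obtain ⟨k, hk⟩ := Submodule.mem_span_singleton.1 (h2 h1)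
      exact ⟨k, hk.symm⟩
    have hker₁ : ∀ X ∈ 𝔥, r₁ X = 0 → ∃ c : ℚ, X = c • c₂ φ₂ := by
      intro X hX hX0
      have hX2 : X = c₂ (r₂ X) := by rw [hc₂, hr₂]; exact eq_corner₂_of_restrict₁_eq_zero ι₁ π₁ ι₂ π₂ hπι₁ hπι₂ hsum hX (by rw [← hr₁]; exact hX0)
      have hK : r₂ X ∈ K₂ := Submodule.mem_comap.2 (by rw [← hX2]; exact hX)
      obtain ⟨c, hc⟩ := hKφ₂ _ hK
      exact ⟨c, by rw [hX2, hc, map_smul]⟩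
    have hker₂ : ∀ X ∈ 𝔥, r₂ X = 0 → ∃ c : ℚ, X = c • c₁ φ₁ := by
      intro X hX hX0
      have hX1 : X = c₁ (r₁ X) := by rw [hc₁, hr₁]; exact eq_corner₂_of_restrict₁_eq_zero ι₂ π₂ ι₁ π₁ hπι₂ hπι₁ hsum' hX (by rw [← hr₂]; exact hX0)
      have hK : r₁ X ∈ K₁ := Submodule.mem_comap.2 (by rw [← hX1]; exact hX)
      obtain ⟨c, hc⟩ := hKφ₁ _ hK
      exact ⟨c, by rw [hX1, hc, map_smul]⟩
    let r₁C : Module.End ℂ (ℂ ⊗[ℚ] V) →ₗ[ℂ] Module.End ℂ (ℂ ⊗[ℚ] V₁) :=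
      (LinearMap.llcomp ℂ _ _ _ (π₁.toLinearMap.baseChange ℂ)).comp (LinearMap.lcomp ℂ _ (ι₁.toLinearMap.baseChange ℂ))
    let r₂C : Module.End ℂ (ℂ ⊗[ℚ] V) →ₗ[ℂ] Module.End ℂ (ℂ ⊗[ℚ] V₂) :=
      (LinearMap.llcomp ℂ _ _ _ (π₂.toLinearMap.baseChange ℂ)).comp (LinearMap.lcomp ℂ _ (ι₂.toLinearMap.baseChange ℂ))
    have hr₁C : ∀ X : Module.End ℚ V, r₁C (X.baseChange ℂ) = (r₁ X).baseChange ℂ := fun X => by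
      change π₁.toLinearMap.baseChange ℂ ∘ₗ X.baseChange ℂ ∘ₗ ι₁.toLinearMap.baseChange ℂ = _
      rw [hr₁, LinearMap.baseChange_comp, LinearMap.baseChange_comp]
    have hr₂C : ∀ X : Module.End ℚ V, r₂C (X.baseChange ℂ) = (r₂ X).baseChange ℂ := fun X => by
      change π₂.toLinearMap.baseChange ℂ ∘ₗ X.baseChange ℂ ∘ₗ ι₂.toLinearMap.baseChange ℂ = _
      rw [hr₂, LinearMap.baseChange_comp, LinearMap.baseChange_comp]
    have hK₁₂ : ∀ Z ∈ spanC H.hodgeLie, π₁.toLinearMap.baseChange ℂ ∘ₗ Z ∘ₗ ι₁.toLinearMap.baseChange ℂ = 0 →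
        ∃ k : ℂ, π₂.toLinearMap.baseChange ℂ ∘ₗ Z ∘ₗ ι₂.toLinearMap.baseChange ℂ = k • φ₂.baseChange ℂ := by
      intro Z hZ hZ0
      obtain ⟨k, rfl⟩ := hcx r₁ r₁C hr₁C (c₂ φ₂) hker₁ hZ hZ0
      refine ⟨k, ?_⟩
      rw [hc₂, LinearMap.baseChange_comp, LinearMap.baseChange_comp]
      refine LinearMap.ext fun x => ?_
      simp only [LinearMap.comp_apply, LinearMap.smul_apply, map_smul, proj_incl_baseChange hπι₂']
    have hK₂₁ : ∀ Z ∈ spanC H.hodgeLie, π₂.toLinearMap.baseChange ℂ ∘ₗ Z ∘ₗ ι₂.toLinearMap.baseChange ℂ = 0 →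
        ∃ k : ℂ, π₁.toLinearMap.baseChange ℂ ∘ₗ Z ∘ₗ ι₁.toLinearMap.baseChange ℂ = k • φ₁.baseChange ℂ := by
      intro Z hZ hZ0
      obtain ⟨k, rfl⟩ := hcx r₂ r₂C hr₂C (c₁ φ₁) hker₂ hZ hZ0
      refine ⟨k, ?_⟩
      rw [hc₁, LinearMap.baseChange_comp, LinearMap.baseChange_comp]
      refine LinearMap.ext fun x => ?_
      simp only [LinearMap.comp_apply, LinearMap.smul_apply, map_smul, proj_incl_baseChange hπι₁']
    obtain ⟨f, hf0, hf⟩ := exists_hodgeMorphism_of_graph ι₁ π₁ ι₂ π₂ hπι₁ hπι₂ hsum hn heff₁ heff₂ ψ₁ ψ₂ ψ hφ₁E hd₁ hφ₁2 hE₁ hμ₁ h1₁ h2₁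
      hφ₂E hd₂ hφ₂2 hE₂ hμ₂ h1₂ h2₂ hrig₁ hK₁₂ hK₂₁ hZ
    exact hf0 (hnohom f hf)
  -- so both derived kernels are everything
  have hle₁ : K₁ ⊓ 𝔡₁ = 𝔡₁ → 𝔡₁.map c₁ ≤ 𝔥 := fun h => by
    rintro _ ⟨d, hd, rfl⟩
    have hd' : d ∈ K₁ ⊓ 𝔡₁ := by rw [h]; exact hd
    exact Submodule.mem_comap.1 (Submodule.mem_inf.1 hd').1
  have hle₂ : K₂ ⊓ 𝔡₂ = 𝔡₂ → 𝔡₂.map c₂ ≤ 𝔥 := fun h => by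
    rintro _ ⟨d, hd, rfl⟩
    have hd' : d ∈ K₂ ⊓ 𝔡₂ := by rw [h]; exact hd
    exact Submodule.mem_comap.1 (Submodule.mem_inf.1 hd').1
  have hfull : K₁ ⊓ 𝔡₁ = 𝔡₁ ∧ K₂ ⊓ 𝔡₂ = 𝔡₂ := by
    rcases hI₁ with h₁ | h₁ <;> rcases hI₂ with h₂ | h₂
    · exact absurd ⟨h₁, h₂⟩ hgraph
    · exact absurd (hle₂ h₂) (hmixed₁ h₁)
    · exact absurd (hle₁ h₁) (hmixed₂ h₂)
    · exact ⟨h₁, h₂⟩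
  have hD₁ := hle₁ hfull.1; have hD₂ := hle₂ hfull.2; refine ⟨hD₁, hD₂, ?_⟩
  -- the two corners are independent, and a lift of `φ₁ ∉ 𝔡₁` lies outside their sum
  have hinj₁ : Function.Injective c₁ := fun a b h => by have h' := congrArg r₁ h; rwa [hr₁c₁, hr₁c₁] at h'
  have hinj₂ : Function.Injective c₂ := fun a b h => by have h' := congrArg r₂ h; rwa [hr₂c₂, hr₂c₂] at h'
  have hdisj : 𝔡₁.map c₁ ⊓ 𝔡₂.map c₂ = ⊥ := by
    refine (Submodule.eq_bot_iff _).2 fun X hX => ?_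
    obtain ⟨hX₁, hX₂⟩ := Submodule.mem_inf.1 hX
    obtain ⟨Y₁, -, rfl⟩ := hX₁
    obtain ⟨Y₂, -, hY⟩ := hX₂
    have h := congrArg r₁ hY
    rw [hr₁c₂, hr₁c₁] at h
    rw [← h, map_zero]
  have hdimD : Module.finrank ℚ ↥(𝔡₁.map c₁ ⊔ 𝔡₂.map c₂) = Module.finrank ℚ 𝔡₁ + Module.finrank ℚ 𝔡₂ := by
    have h := Submodule.finrank_sup_add_finrank_inf_eq (𝔡₁.map c₁) (𝔡₂.map c₂)
    rw [hdisj, finrank_bot, add_zero, ← LinearEquiv.finrank_eq (Submodule.equivMapOfInjective c₁ hinj₁ 𝔡₁),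
      ← LinearEquiv.finrank_eq (Submodule.equivMapOfInjective c₂ hinj₂ 𝔡₂)] at h
    exact h
  haveI : Nontrivial V₁ := Module.nontrivial_of_finrank_pos (R := ℚ) (by
    have h := Submodule.finrank_le (Module.End.eigenspace (φ₁.baseChange ℂ) μ₁ ⊓ H₁.piece 0 1)
    rw [Module.finrank_baseChange] at h; omega)
  obtain ⟨Xt, hXt, hXtφ⟩ := exists_restrict_eq_of_rigid ι₁ π₁ hπι₁ hrig₁ hφ₁𝔥
  have hXtD : Xt ∉ 𝔡₁.map c₁ ⊔ 𝔡₂.map c₂ := by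
    intro hmem
    obtain ⟨A, hA, B, hB, hAB⟩ := Submodule.mem_sup.1 hmem
    obtain ⟨Y₁, hY₁, rfl⟩ := hA
    obtain ⟨Y₂, -, rfl⟩ := hB
    have h := congrArg r₁ hAB
    rw [map_add, hr₁c₁, hr₁c₂, add_zero, hr₁, hXtφ] at h
    rw [h] at hY₁
    have htr := trace_mul_eq_zero_of_mem_derived_of_mem_endAlg (H₁ := H₁) hφ₁E hY₁
    rw [hφ₁2, map_neg, map_smul, LinearMap.trace_one, smul_eq_mul, neg_eq_zero, mul_eq_zero] at htr
    rcases htr with h' | h'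
    · exact hd₁.ne' h'
    · exact Module.finrank_pos.ne' (by exact_mod_cast h')
  have h := Submodule.finrank_lt_finrank_of_lt (lt_of_le_of_ne (sup_le hD₁ hD₂) (fun heq => hXtD (heq ▸ hXt)))
  omega

end Main

end UnitaryPair

end Summit.HodgeConjecture.CorCM

end
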